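import Literature.Barriers.HubbardSuperconductivity.HohenbergMerminWagnerPairing
import Literature.MathematicalPhysics.QuantumLattice.DWaveSource
import HarnessLib

/-!
# Barrier `HohenbergMerminWagnerPairing`, quasi-average form: no SOURCED pair-field order at `T > 0` in two
dimensions (Su–Suzuki 1998; Koma–Tasaki 1992 p. 3), proved by the McBryan–Spencer gauge bound

Companion of `HohenbergMerminWagnerPairing.lean` (barrier catalogue `Literature/Barriers/HubbardSuperconductivity/`,
D-0021). That entry PROVES the two-point form of the Hohenberg–Mermin–Wagner obstruction (no pair-field long-range
order of the Gibbs state at any `0 ≤ β < ∞`, `not_positiveTemperaturePairFieldOrder`) and lists in its `blocks:` (c)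
the QUASI-AVERAGE form — "the `d_{x²-y²}` order parameter `g = lim_{ν→0+} lim_{M→∞} ⟨Δ_d⁺⟩/M` of the Hubbard
model … vanishes at every `T > 0` in `d = 1, 2`" [Su–Suzuki 1998] — citing it from print only. This file
PROVES the quasi-average form for the nearest-neighbour Hubbard model on the tori `(ℤ/Lℤ)²`, for every
finite-range singlet pair field, with an explicit bound UNIFORM IN THE VOLUME (so no order of limits is needed):

* `norm_gibbsState_bondPair_sourced_le_exp` — Koma–Tasaki's a priori gauge bound (their eqs. (5)–(12)) for the
  ONE-point function of a bond pair `b_{uv}` in the Gibbs state of the Hubbard Hamiltonian on an arbitrary finite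
  graph PERTURBED BY A HERMITIAN BOND-PAIR SOURCE `-h Σ_i w_i (b_i + b_i†)`: for every real site function `φ`,
  `|⟨b_{uv}⟩_{β,h}| ≤ 2 e^{φ_u+φ_v} exp[β(|t| Σ_{x∼y} 2(cosh(φ_x-φ_y)-1) + |h| Σ_i |w_i|·4(cosh(φ_{a_i}+φ_{b_i})-1))]`.
  The only new ingredient w.r.t. the tree's two-point bound is the gauge cost of the source: the Hermitian part of
  the conjugated source is `2cosh(φ_a+φ_b)` times the source (`siteGauge_conj_bondPairSource_add_conjTranspose`),
  leaving a bounded remainder; the abstract trace inequality is the tree's `norm_gibbsState_le_of_gauge`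
  (trace Cauchy–Schwarz, Bernstein, Golden–Thompson).
* `norm_gibbsState_bondPair_pairSource_torus_le`, `norm_gibbsState_localPair_pairSource_torus_le` — on `(ℤ/Lℤ)²`
  with the source `-h(Δ_g + Δ_g†)` (`Δ_g = pairField g L`; for `t = 1`, `g = dWaveFormFactor` this IS the tree's
  `dWaveSourceTorus L U μ h`): for every radius `R`,
  `|⟨P_o⟩_{β,h,L}| ≤ A_g · 2e (R+1)^{-f(β|t|)} · exp(β|h|·64 A_g e^{2H(R)} R² H(R))`
  (`f = pairDecayExponent > 0` of the sibling file, `A_g = Σ_e |g e/√2|`, `H` = harmonic numbers), uniformly in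
  `L, U, μ, o`. The test function is the sibling's `radialPotential` SHIFTED by its far value, `ψ = φ - qH(R)`
  (`q = 1/(1+128β|t|)`): the observable at the centre pays `e^{-2qH(R)+q}`, the hopping pays the Dirichlet energy
  `e^{128β|t|q²H(R)}` (unchanged by the shift), and the source — whose gauge cost lives on the ball of radius `R`
  only, where `|ψ| ≤ qH(R)` — pays `exp(β|h|·64A_g e^{2qH(R)}R²H(R))` (ball count `≤ 8R²H(R)` through the
  sibling's `sum_indicator_inv_sq_le`).
* `gibbsState_localPair_pairSource_small`, `gibbsState_pairField_density_small` — hence for every `β ≥ 0`, `t`,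
  `g` and `ε > 0` there is `h₀ > 0` with `|⟨P_o⟩_{β,h,L}| ≤ ε` and `|⟨Δ_g⟩_{β,h,L}|/L² ≤ ε` for ALL `|h| ≤ h₀`,
  `L`, `U`, `μ`, `o` (`R` large, then `h₀` small): the Bogoliubov quasi-average of any finite-range singlet pair
  field vanishes at every positive temperature, `lim_{h→0} limsup_L |⟨Δ_g⟩_{β,h,L}|/L² = 0`.
* `thermal_dWaveSourceDensity_small` — the `d_{x²-y²}` case over `dWaveSourceTorus`: the THERMAL twin of the
  tree's ground-state `dWaveSourceDensity`/`dWaveOrderParameter`/`HasDWaveOrder` (Koma–Tasaki's sourced order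
  parameter, the object of crux `WcbcsBcsConstruction` of route WeakCouplingBCS of summit
  `HubbardSuperconductivity`) is `≤ ε` uniformly once `|h| ≤ h₀(β, ε)`, at every `β < ∞`.

Reading for the summit's bridge audit (LADDER-Hubbard wording (ii), cell gate-hubbard-kl): a positive-temperature
theorem — e.g. the Kohn–Luttinger pair, which controls Gibbs states at `L`-independent `β ≤ e^{c/U²}` — cannot
feed the summit through a sourced (quasi-average) pair order parameter any more than through two-point long-range
order: both are identically trivial at every `β < ∞` in `d = 2`. The printed route to this statement is Bogoliubov's
inequality [Su–Suzuki 1998, (5)–(14): `|g| ≤ (ξβ/π)^{1/2}|ln|ν||^{-1/2}`]; the McBryan–Spencer/Koma–Tasaki gauge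
route used here gives instead a power of `h` (`(R+1)^{-f}` at `R ≍ (β|h|)^{-1/4}`), with cruder constants, and
is uniform in `U`, `μ` and the volume. Nothing is asserted at `T = 0`.

Sources: G. Su, M. Suzuki, Phys. Rev. B 58 (1998) 117, abstract, (3), (13)–(14) (`SuSuzuki1998`); T. Koma,
H. Tasaki, PRL 68 (1992) 3248, eqs. (5)–(12), p. 3 and footnote [10] (`KomaTasakiPRL1992`); O. McBryan,
T. Spencer, CMP 53 (1977) 299 (`McBryanSpencer1977`); T. Koma, H. Tasaki, J. Stat. Phys. 76 (1994) 745 §1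
(the sourced order parameter; `KomaTasaki1994`). No definition and no named fact is introduced.

## Mathlib / tree search

REUSED: `bondPair`, `siteGauge_mul_bondPair_mul`, `siteGauge_mul_bondPair_conjTranspose_mul`,
`norm_bondPair_le_two`, `radialPotential` (+ `_center`, `_le`, `_nonneg`, `_of_le`, `_le_of`, `_energy_le`),
`pairDecayExponent` (+ `_pos`, `_eq`), `localPair_eq_sum_bondPair`, `torusDist_add_proj_le_one`
(`HohenbergMerminWagnerPairing`); `norm_gibbsState_le_of_gauge` (`HubbardHubbardModelPairDecayProofs`);
`siteGauge`, `siteGauge_inv`, `isUnit_siteGauge`, `siteGauge_conj_hamiltonianWith_add_conjTranspose`,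
`norm_hoppingPerturbation_le`, `isHermitian_hamiltonianWith` (`HubbardGaugeBound`); `sum_indicator_inv_sq_le`
(`TorusTestPotential`); `dWaveSourceTorus` (`DWaveSource`); Mathlib `log_add_one_le_harmonic`,
`tendsto_rpow_neg_atTop`, `Real.exp_one_lt_d9`. `lean search 'quasi|sourced.*thermal|thermalOnePoint'`: no
positive-temperature one-point (sourced) pair bound existed in the tree (2026-08-26).
-/

noncomputable section

open Matrix Finset NormedSpace Literature.MathematicalPhysics.QuantumLattice Literature.Probability.LatticeModels
open scoped Matrix.Norms.L2Operator ComplexOrder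

namespace Literature.Barriers.HubbardSuperconductivity

/-! ### The sourced Hamiltonian on a finite graph: gauge covariance of a bond-pair source -/

section Graph

variable {Λ : Type*} [LinearOrder Λ] [Fintype Λ]

/-- `‖b_{uv} + (b_{uv})†‖ ≤ 4`. [folklore] -/
private theorem norm_bondPair_add_conjTranspose_le_four (u v : Λ) :
    ‖(bondPair u v + (bondPair u v)ᴴ : Matrix (Finset (Orb Λ)) (Finset (Orb Λ)) ℂ)‖ ≤ 4 := by
  refine (norm_add_le _ _).trans ?_
  rw [l2_opNorm_conjTranspose]
  linarith [norm_bondPair_le_two u v]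

/-- Gauge conjugation of the Hermitian bond-pair term: `G(φ)(b_{uv} + b_{uv}†)G(φ)⁻¹ =
e^{φ_u+φ_v} b_{uv} + e^{-(φ_u+φ_v)} b_{uv}†`. [cite: KomaTasakiPRL1992, eq. (8)] -/
theorem siteGauge_mul_bondPairHerm_mul (φ : Λ → ℝ) (u v : Λ) :
    siteGauge φ * (bondPair u v + (bondPair u v)ᴴ) * siteGauge (-φ) =
      ((Real.exp (φ u + φ v) : ℝ) : ℂ) • bondPair u v +
        ((Real.exp (-(φ u + φ v)) : ℝ) : ℂ) • (bondPair u v)ᴴ := by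
  rw [Matrix.mul_add, Matrix.add_mul, siteGauge_mul_bondPair_mul,
    siteGauge_mul_bondPair_conjTranspose_mul]

/-- Hermitian part of the gauge-conjugated bond-pair term:
`G O G⁻¹ + (G O G⁻¹)† = 2 cosh(φ_u+φ_v) · O` for `O = b_{uv} + b_{uv}†`. [cite: KomaTasakiPRL1992, eqs. (8)–(9)] -/
theorem siteGauge_conj_bondPairHerm_add_conjTranspose (φ : Λ → ℝ) (u v : Λ) :
    siteGauge φ * (bondPair u v + (bondPair u v)ᴴ) * siteGauge (-φ) +
        (siteGauge φ * (bondPair u v + (bondPair u v)ᴴ) * siteGauge (-φ))ᴴ =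
      ((2 * Real.cosh (φ u + φ v) : ℝ) : ℂ) • (bondPair u v + (bondPair u v)ᴴ) := by
  rw [siteGauge_mul_bondPairHerm_mul, conjTranspose_add, conjTranspose_smul, conjTranspose_smul,
    conjTranspose_conjTranspose]
  have h1 : star ((Real.exp (φ u + φ v) : ℝ) : ℂ) = ((Real.exp (φ u + φ v) : ℝ) : ℂ) :=
    Complex.conj_ofReal _
  have h2 : star ((Real.exp (-(φ u + φ v)) : ℝ) : ℂ) = ((Real.exp (-(φ u + φ v)) : ℝ) : ℂ) :=
    Complex.conj_ofReal _
  rw [h1, h2, Real.cosh_eq]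
  push_cast
  module

/-- Hermitian part of the gauge-conjugated bond-pair SOURCE `O = Σ_{i∈s} w_i (b_{a_i b_i} + b_{a_i b_i}†)`:
`G O G⁻¹ + (G O G⁻¹)† = 2 Σ_i w_i cosh(φ_{a_i}+φ_{b_i}) (b_{a_i b_i} + b_{a_i b_i}†)`.
[cite: KomaTasakiPRL1992, eqs. (8)–(9)] -/
theorem siteGauge_conj_bondPairSource_add_conjTranspose (φ : Λ → ℝ) {ι : Type*} (s : Finset ι)
    (w : ι → ℝ) (a b : ι → Λ) :
    siteGauge φ * (∑ i ∈ s, ((w i : ℝ) : ℂ) • (bondPair (a i) (b i) + (bondPair (a i) (b i))ᴴ)) *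
          siteGauge (-φ) +
        (siteGauge φ * (∑ i ∈ s, ((w i : ℝ) : ℂ) • (bondPair (a i) (b i) + (bondPair (a i) (b i))ᴴ)) *
          siteGauge (-φ))ᴴ =
      (2 : ℂ) • ∑ i ∈ s, ((w i * Real.cosh (φ (a i) + φ (b i)) : ℝ) : ℂ) •
        (bondPair (a i) (b i) + (bondPair (a i) (b i))ᴴ) := by
  rw [Finset.mul_sum, Finset.sum_mul, conjTranspose_sum, ← Finset.sum_add_distrib, Finset.smul_sum]
  refine Finset.sum_congr rfl fun i _ => ?_
  rw [Matrix.mul_smul, Matrix.smul_mul, conjTranspose_smul, Complex.star_def, Complex.conj_ofReal,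
    ← smul_add, siteGauge_conj_bondPairHerm_add_conjTranspose, smul_smul, smul_smul]
  congr 1
  push_cast
  ring

/-- The bond-pair source is Hermitian. [folklore] -/
private theorem isHermitian_bondPairSource {ι : Type*} (s : Finset ι) (w : ι → ℝ) (a b : ι → Λ) :
    (∑ i ∈ s, ((w i : ℝ) : ℂ) • (bondPair (a i) (b i) + (bondPair (a i) (b i))ᴴ) :
      Matrix (Finset (Orb Λ)) (Finset (Orb Λ)) ℂ).IsHermitian := by
  rw [Matrix.IsHermitian, conjTranspose_sum]
  refine Finset.sum_congr rfl fun i _ => ?_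
  rw [conjTranspose_smul, conjTranspose_add, conjTranspose_conjTranspose, Complex.star_def,
    Complex.conj_ofReal, add_comm]

/-- Norm of the source's gauge remainder: `‖Σ_i w_i(1 - cosh s_i)(b_i + b_i†)‖ ≤ Σ_i |w_i|·4(cosh s_i - 1)`.
[folklore] -/
private theorem norm_bondPairSource_remainder_le (φ : Λ → ℝ) {ι : Type*} (s : Finset ι) (w : ι → ℝ)
    (a b : ι → Λ) :
    ‖(∑ i ∈ s, ((w i * (1 - Real.cosh (φ (a i) + φ (b i))) : ℝ) : ℂ) •
        (bondPair (a i) (b i) + (bondPair (a i) (b i))ᴴ) : Matrix (Finset (Orb Λ)) (Finset (Orb Λ)) ℂ)‖ ≤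
      ∑ i ∈ s, |w i| * (4 * (Real.cosh (φ (a i) + φ (b i)) - 1)) := by
  refine (norm_sum_le _ _).trans (Finset.sum_le_sum fun i _ => ?_)
  rw [norm_smul, Complex.norm_real, Real.norm_eq_abs, abs_mul,
    abs_of_nonpos (sub_nonpos.2 (Real.one_le_cosh _))]
  have h4 := norm_bondPair_add_conjTranspose_le_four (a i) (b i)
  have hc : 0 ≤ Real.cosh (φ (a i) + φ (b i)) - 1 := sub_nonneg.2 (Real.one_le_cosh _)
  calc |w i| * -(1 - Real.cosh (φ (a i) + φ (b i))) *
        ‖(bondPair (a i) (b i) + (bondPair (a i) (b i))ᴴ : Matrix (Finset (Orb Λ)) (Finset (Orb Λ)) ℂ)‖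
      ≤ |w i| * -(1 - Real.cosh (φ (a i) + φ (b i))) * 4 := by
        refine mul_le_mul_of_nonneg_left h4 ?_
        exact mul_nonneg (abs_nonneg _) (by linarith)
    _ = |w i| * (4 * (Real.cosh (φ (a i) + φ (b i)) - 1)) := by ring

variable (G : SimpleGraph Λ) [DecidableRel G.Adj]

/-- **Koma–Tasaki's a priori bound with a bond-pair SOURCE, one-point version.** For the grand-canonical
Hubbard model on a finite graph perturbed by a Hermitian pair source,
`H_h = H(t,U) - μN - h Σ_{i∈s} w_i (b_{a_i b_i} + b_{a_i b_i}†)` (real weights), every real site function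
`φ`, `β ≥ 0` and sites `u, v`:
`|⟨b_{uv}⟩_{β,h}| ≤ 2 e^{φ_u+φ_v} exp[β(|t| Σ_{x∼y} 2(cosh(φ_x-φ_y)-1) + |h| Σ_i |w_i|·4(cosh(φ_{a_i}+φ_{b_i})-1))]`.
The hopping cost is Koma–Tasaki's eq. (11); the new term is the gauge cost of the source, whose
conjugated Hermitian part is `2cosh(φ_a+φ_b)` times itself (`siteGauge_conj_bondPairSource_add_conjTranspose`),
leaving the bounded remainder `h Σ w_i (1-cosh)(b+b†)`. Fed to the tree's `norm_gibbsState_le_of_gauge`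
(trace Cauchy–Schwarz, Bernstein, Golden–Thompson). [cite: KomaTasakiPRL1992, eqs. (6)–(12) and footnote [10]] -/
theorem norm_gibbsState_bondPair_sourced_le_exp (t U μ h : ℝ) {β : ℝ} (hβ : 0 ≤ β) (φ : Λ → ℝ)
    {ι : Type*} (s : Finset ι) (w : ι → ℝ) (a b : ι → Λ) (u v : Λ) :
    ‖gibbsState β (hamiltonianWith G t U μ -
        (h : ℂ) • ∑ i ∈ s, ((w i : ℝ) : ℂ) • (bondPair (a i) (b i) + (bondPair (a i) (b i))ᴴ))
        (bondPair u v)‖ ≤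
      2 * Real.exp (φ u + φ v) *
        Real.exp (β * (|t| * (∑ x : Λ, ∑ y : Λ,
            if G.Adj x y then 2 * (Real.cosh (φ x - φ y) - 1) else 0) +
          |h| * ∑ i ∈ s, |w i| * (4 * (Real.cosh (φ (a i) + φ (b i)) - 1)))) := by
  set H₀ : Matrix (Finset (Orb Λ)) (Finset (Orb Λ)) ℂ := hamiltonianWith G t U μ with hH₀_def
  set O : Matrix (Finset (Orb Λ)) (Finset (Orb Λ)) ℂ :=
    ∑ i ∈ s, ((w i : ℝ) : ℂ) • (bondPair (a i) (b i) + (bondPair (a i) (b i))ᴴ) with hO_def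
  set Oc : Matrix (Finset (Orb Λ)) (Finset (Orb Λ)) ℂ :=
    ∑ i ∈ s, ((w i * Real.cosh (φ (a i) + φ (b i)) : ℝ) : ℂ) •
      (bondPair (a i) (b i) + (bondPair (a i) (b i))ᴴ) with hOc_def
  set H : Matrix (Finset (Orb Λ)) (Finset (Orb Λ)) ℂ := H₀ - (h : ℂ) • O with hH_def
  set A : Matrix (Finset (Orb Λ)) (Finset (Orb Λ)) ℂ := bondPair u v with hA_def
  set V₀ : Matrix (Finset (Orb Λ)) (Finset (Orb Λ)) ℂ :=
    -(t : ℂ) • hoppingForm G (fun x y => Real.cosh (φ x - φ y) - 1) with hV₀_def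
  set Vs : Matrix (Finset (Orb Λ)) (Finset (Orb Λ)) ℂ :=
    (h : ℂ) • ∑ i ∈ s, ((w i * (1 - Real.cosh (φ (a i) + φ (b i))) : ℝ) : ℂ) •
      (bondPair (a i) (b i) + (bondPair (a i) (b i))ᴴ) with hVs_def
  set c₀ : ℝ := |t| * ∑ x : Λ, ∑ y : Λ,
    if G.Adj x y then 2 * (Real.cosh (φ x - φ y) - 1) else 0 with hc₀_def
  set cs : ℝ := |h| * ∑ i ∈ s, |w i| * (4 * (Real.cosh (φ (a i) + φ (b i)) - 1)) with hcs_def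
  -- Hermiticity
  have hO : O.IsHermitian := isHermitian_bondPairSource s w a b
  have hH₀ : H₀.IsHermitian := isHermitian_hamiltonianWith G t U μ
  have hH : H.IsHermitian := by
    change (H₀ - (h : ℂ) • O)ᴴ = H₀ - (h : ℂ) • O
    rw [conjTranspose_sub, conjTranspose_smul, hO.eq, hH₀.eq, Complex.star_def, Complex.conj_ofReal]
  -- the source remainder, rewritten
  have hVs_eq : Vs = (h : ℂ) • O - (h : ℂ) • Oc := by
    rw [hVs_def, hO_def, hOc_def, ← smul_sub, ← Finset.sum_sub_distrib]
    congr 1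
    refine Finset.sum_congr rfl fun i _ => ?_
    rw [← sub_smul]
    congr 1
    push_cast
    ring
  -- the observable is a gauge eigenvector
  have hD : IsUnit (siteGauge φ) := isUnit_siteGauge φ
  have hA : siteGauge φ * A * (siteGauge φ)⁻¹ = ((Real.exp (φ u + φ v) : ℝ) : ℂ) • A := by
    rw [siteGauge_inv]
    exact siteGauge_mul_bondPair_mul φ u v
  -- the Hermitian part of the conjugated Hamiltonian
  have e1 := siteGauge_conj_hamiltonianWith_add_conjTranspose G φ t U μ
  have e2 := siteGauge_conj_bondPairSource_add_conjTranspose φ s w a b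
  have hV : siteGauge φ * H * (siteGauge φ)⁻¹ + (siteGauge φ * H * (siteGauge φ)⁻¹)ᴴ =
      (2 : ℂ) • (H + (V₀ + Vs)) := by
    rw [siteGauge_inv, hH_def, Matrix.mul_sub, Matrix.sub_mul, conjTranspose_sub, Matrix.mul_smul,
      Matrix.smul_mul, conjTranspose_smul, Complex.star_def, Complex.conj_ofReal]
    calc siteGauge φ * H₀ * siteGauge (-φ) - (h : ℂ) • (siteGauge φ * O * siteGauge (-φ)) +
          ((siteGauge φ * H₀ * siteGauge (-φ))ᴴ - (h : ℂ) • (siteGauge φ * O * siteGauge (-φ))ᴴ)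
        = (siteGauge φ * H₀ * siteGauge (-φ) + (siteGauge φ * H₀ * siteGauge (-φ))ᴴ) -
            (h : ℂ) • (siteGauge φ * O * siteGauge (-φ) + (siteGauge φ * O * siteGauge (-φ))ᴴ) := by
          rw [smul_add]; abel
      _ = (2 : ℂ) • (H₀ + V₀) - (h : ℂ) • ((2 : ℂ) • Oc) := by rw [e1, hO_def, e2]
      _ = (2 : ℂ) • (H₀ - (h : ℂ) • O + (V₀ + Vs)) := by rw [hVs_eq]; module
  have hc : ‖V₀ + Vs‖ ≤ c₀ + cs := by
    refine (norm_add_le _ _).trans (add_le_add (norm_hoppingPerturbation_le G φ t) ?_)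
    rw [hVs_def, norm_smul, Complex.norm_real, Real.norm_eq_abs, hcs_def]
    exact mul_le_mul_of_nonneg_left (norm_bondPairSource_remainder_le φ s w a b) (abs_nonneg h)
  have key := norm_gibbsState_le_of_gauge hH hD hA hV hc hβ
  have hκ : ‖((Real.exp (φ u + φ v) : ℝ) : ℂ)‖ = Real.exp (φ u + φ v) := by
    rw [Complex.norm_real, Real.norm_of_nonneg (Real.exp_pos _).le]
  calc ‖gibbsState β H A‖
      ≤ ‖((Real.exp (φ u + φ v) : ℝ) : ℂ)‖ * ‖A‖ * Real.exp (β * (c₀ + cs)) := key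
    _ ≤ ‖((Real.exp (φ u + φ v) : ℝ) : ℂ)‖ * 2 * Real.exp (β * (c₀ + cs)) := by
        gcongr
        exact norm_bondPair_le_two u v
    _ = 2 * Real.exp (φ u + φ v) * Real.exp (β * (c₀ + cs)) := by rw [hκ]; ring

end Graph


/-! ### The torus `(ℤ/Lℤ)²`: the pair-field source, the shifted radial potential, counting -/

section Torus

variable (g : Site 2 → ℝ) (L : ℕ) [NeZero L]

/-- The Hermitian pair-field source `Δ_g + Δ_g†` as a bond-pair source indexed by (site, step):
`Δ_g + Δ_g† = Σ_{(x,e) ∈ Λ_L × {0,±e₁,±e₂}} (g e/√2)(b_{x,x+e} + b_{x,x+e}†)`. [folklore] -/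
private theorem pairField_add_conjTranspose_eq_bondPairSource :
    pairField g L + (pairField g L)ᴴ =
      ∑ p ∈ (Finset.univ : Finset (TorusSite 2 L)) ×ˢ insert (0 : Site 2) unitSteps,
        ((g p.2 / Real.sqrt 2 : ℝ) : ℂ) •
          (bondPair (FermionTorus.ofTorusSite p.1) (FermionTorus.ofTorusSite (p.1 + Torus.proj L p.2)) +
            (bondPair (FermionTorus.ofTorusSite p.1)
              (FermionTorus.ofTorusSite (p.1 + Torus.proj L p.2)))ᴴ) := by
  rw [Finset.sum_product, pairField, conjTranspose_sum, ← Finset.sum_add_distrib]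
  refine Finset.sum_congr rfl fun x _ => ?_
  rw [localPair_eq_sum_bondPair, conjTranspose_sum, ← Finset.sum_add_distrib]
  refine Finset.sum_congr rfl fun e _ => ?_
  rw [conjTranspose_smul, Complex.star_def, Complex.conj_ofReal, smul_add]

/-- The `ℓ¹`-weight of the form factor, `A_g = Σ_{e ∈ {0,±e₁,±e₂}} |g e/√2|`. [folklore] -/
private theorem formFactorWeight_nonneg : 0 ≤ ∑ e ∈ insert (0 : Site 2) unitSteps, |g e / Real.sqrt 2| :=
  Finset.sum_nonneg fun _ _ => abs_nonneg _

variable {L}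

/-- Counting the open ball of the torus metric through the tree's radial sum:
`#{u : dist(u, o) < R} ≤ 8 R² H(R)` (each site of the ball has `1 ≤ R²/(dist+1)²`, and
`Σ_{dist<R} (dist+1)⁻² ≤ 8 H(R)`, `sum_indicator_inv_sq_le`). [folklore] -/
private theorem sum_indicator_torusDist_lt_le (o : TorusSite 2 L) (R : ℕ) :
    ∑ u : TorusSite 2 L, (if torusDist u o < R then (1 : ℝ) else 0) ≤
      8 * (R : ℝ) ^ 2 * (harmonic R : ℝ) := by
  have h := sum_indicator_inv_sq_le L o R
  calc ∑ u : TorusSite 2 L, (if torusDist u o < R then (1 : ℝ) else 0)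
      ≤ ∑ u : TorusSite 2 L, (R : ℝ) ^ 2 *
          (if torusDist u o < R then (((torusDist u o : ℝ) + 1) ^ 2)⁻¹ else 0) := by
        refine Finset.sum_le_sum fun u _ => ?_
        split_ifs with hu
        · have h1 : ((torusDist u o : ℝ) + 1) ≤ (R : ℝ) := by
            exact_mod_cast Nat.lt_iff_add_one_le.mp hu
          have hpos : (0 : ℝ) < ((torusDist u o : ℝ) + 1) ^ 2 := by positivity
          rw [← div_eq_mul_inv, le_div_iff₀ hpos, one_mul]
          exact pow_le_pow_left₀ (by positivity) h1 2
        · simp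
    _ = (R : ℝ) ^ 2 * ∑ u : TorusSite 2 L,
          (if torusDist u o < R then (((torusDist u o : ℝ) + 1) ^ 2)⁻¹ else 0) := by
        rw [Finset.mul_sum]
    _ ≤ (R : ℝ) ^ 2 * (8 * (harmonic R : ℝ)) := mul_le_mul_of_nonneg_left h (by positivity)
    _ = 8 * (R : ℝ) ^ 2 * (harmonic R : ℝ) := by ring


/-- `cosh s - 1 ≤ e^M` whenever `|s| ≤ M`. [folklore] -/
private theorem cosh_sub_one_le_exp_of_abs_le {s M : ℝ} (h : |s| ≤ M) : Real.cosh s - 1 ≤ Real.exp M := by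
  have h1 : s ≤ M := (le_abs_self s).trans h
  have h2 : -s ≤ M := (neg_le_abs s).trans h
  rw [Real.cosh_eq]
  have e1 : Real.exp s ≤ Real.exp M := Real.exp_le_exp.2 h1
  have e2 : Real.exp (-s) ≤ Real.exp M := Real.exp_le_exp.2 h2
  linarith [Real.exp_pos M]

omit [NeZero L] in
/-- **The shifted radial potential** `ψ_u = φ_u - qH(R)` (`φ` = `radialPotential` centred at `o`, truncated at
`R`): `ψ ≤ 0`, `ψ = 0` outside the open ball of radius `R`, `ψ_o = -qH(R)`. Pointwise gauge cost of the
pair source under `ψ`: `cosh(ψ_x + ψ_y) - 1 ≤ e^{2qH(R)} · (𝟙[dist(x,o) < R] + 𝟙[dist(y,o) < R])` — zero unless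
one end of the bond lies in the ball. [folklore] -/
private theorem cosh_shifted_sub_one_le (o : TorusSite 2 L) (R : ℕ) {q : ℝ} (hq : 0 ≤ q) (x y : TorusSite 2 L) :
    Real.cosh ((radialPotential L o R q x - q * (harmonic R : ℝ)) +
        (radialPotential L o R q y - q * (harmonic R : ℝ))) - 1 ≤
      Real.exp (2 * (q * (harmonic R : ℝ))) *
        ((if torusDist x o < R then (1 : ℝ) else 0) + (if torusDist y o < R then (1 : ℝ) else 0)) := by
  have hxl := radialPotential_le o R hq x
  have hyl := radialPotential_le o R hq y
  have hx0 := radialPotential_nonneg o R hq x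
  have hy0 := radialPotential_nonneg o R hq y
  by_cases hx : torusDist x o < R
  · rw [if_pos hx]
    refine (cosh_sub_one_le_exp_of_abs_le (M := 2 * (q * (harmonic R : ℝ))) ?_).trans ?_
    · rw [abs_le]; constructor <;> linarith
    · have : (0 : ℝ) ≤ if torusDist y o < R then (1 : ℝ) else 0 := by split_ifs <;> norm_num
      nlinarith [Real.exp_pos (2 * (q * (harmonic R : ℝ)))]
  · by_cases hy : torusDist y o < R
    · rw [if_neg hx, if_pos hy]
      refine (cosh_sub_one_le_exp_of_abs_le (M := 2 * (q * (harmonic R : ℝ))) ?_).trans (by simp)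
      rw [abs_le]; constructor <;> linarith
    · rw [if_neg hx, if_neg hy, radialPotential_of_le o q (not_lt.mp hx),
        radialPotential_of_le o q (not_lt.mp hy)]
      simp

/-- The source's total gauge cost under the shifted radial potential:
`Σ_{(x,e)} |g e/√2| · 4(cosh(ψ_x + ψ_{x+e}) - 1) ≤ 64 A_g e^{2qH(R)} R² H(R)`, `A_g = Σ_e |g e/√2|`
(translation invariance of the count `#{x : dist(x+e, o) < R} = #{x : dist(x, o) < R} ≤ 8R²H(R)`). [folklore] -/
private theorem sourceCost_shifted_le (o : TorusSite 2 L) (R : ℕ) {q : ℝ} (hq : 0 ≤ q) :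
    ∑ p ∈ (Finset.univ : Finset (TorusSite 2 L)) ×ˢ insert (0 : Site 2) unitSteps,
        |g p.2 / Real.sqrt 2| * (4 * (Real.cosh
          ((radialPotential L o R q p.1 - q * (harmonic R : ℝ)) +
            (radialPotential L o R q (p.1 + Torus.proj L p.2) - q * (harmonic R : ℝ))) - 1)) ≤
      64 * (∑ e ∈ insert (0 : Site 2) unitSteps, |g e / Real.sqrt 2|) *
        Real.exp (2 * (q * (harmonic R : ℝ))) * (R : ℝ) ^ 2 * (harmonic R : ℝ) := by
  set S : Finset (Site 2) := insert (0 : Site 2) unitSteps with hS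
  set E : ℝ := Real.exp (2 * (q * (harmonic R : ℝ))) with hE
  set N : ℝ := ∑ u : TorusSite 2 L, (if torusDist u o < R then (1 : ℝ) else 0) with hN
  have hN0 : 0 ≤ N := Finset.sum_nonneg fun u _ => by split_ifs <;> norm_num
  have hNle : N ≤ 8 * (R : ℝ) ^ 2 * (harmonic R : ℝ) := sum_indicator_torusDist_lt_le o R
  -- translation invariance of the ball count
  have htrans : ∀ e : Site 2, ∑ x : TorusSite 2 L,
      (if torusDist (x + Torus.proj L e) o < R then (1 : ℝ) else 0) = N := by
    intro e
    rw [hN]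
    exact Fintype.sum_equiv (Equiv.addRight (Torus.proj L e)) _ _ fun x => rfl
  rw [Finset.sum_product, Finset.sum_comm]
  calc ∑ e ∈ S, ∑ x : TorusSite 2 L, |g e / Real.sqrt 2| * (4 * (Real.cosh
          ((radialPotential L o R q x - q * (harmonic R : ℝ)) +
            (radialPotential L o R q (x + Torus.proj L e) - q * (harmonic R : ℝ))) - 1))
      ≤ ∑ e ∈ S, ∑ x : TorusSite 2 L, |g e / Real.sqrt 2| * (4 * (E *
          ((if torusDist x o < R then (1 : ℝ) else 0) +
            (if torusDist (x + Torus.proj L e) o < R then (1 : ℝ) else 0)))) := by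
        refine Finset.sum_le_sum fun e _ => Finset.sum_le_sum fun x _ => ?_
        refine mul_le_mul_of_nonneg_left ?_ (abs_nonneg _)
        exact mul_le_mul_of_nonneg_left (cosh_shifted_sub_one_le o R hq x _) (by norm_num)
    _ = ∑ e ∈ S, |g e / Real.sqrt 2| * (4 * E) * (N + N) := by
        refine Finset.sum_congr rfl fun e _ => ?_
        rw [← Finset.mul_sum, ← Finset.mul_sum, ← Finset.mul_sum, Finset.sum_add_distrib, htrans e, ← hN]
        ring
    _ = (∑ e ∈ S, |g e / Real.sqrt 2|) * (8 * E * N) := by rw [Finset.sum_mul]; refine Finset.sum_congr rfl fun e _ => ?_; ring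
    _ ≤ (∑ e ∈ S, |g e / Real.sqrt 2|) * (8 * E * (8 * (R : ℝ) ^ 2 * (harmonic R : ℝ))) := by
        refine mul_le_mul_of_nonneg_left ?_ (formFactorWeight_nonneg g)
        exact mul_le_mul_of_nonneg_left hNle (by positivity)
    _ = 64 * (∑ e ∈ S, |g e / Real.sqrt 2|) * E * (R : ℝ) ^ 2 * (harmonic R : ℝ) := by ring


/-- **One-point Koma–Tasaki bound with the pair-field source, on `(ℤ/Lℤ)²`.** For the Gibbs state of the
SOURCED grand-canonical Hubbard torus `H_{L,h} = H(t,U) - μN - h(Δ_g + Δ_g†)` (`Δ_g = pairField g L`; for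
`t = 1`, `g = dWaveFormFactor` this is the tree's `dWaveSourceTorus L U μ h`), every `β ≥ 0`, every site `o`
and partner `o'` with `dist(o', o) ≤ 1`, and EVERY truncation radius `R`:
`|⟨b_{o o'}⟩_{β,h,L}| ≤ 2e · (R+1)^{-f(β|t|)} · exp(β|h| · 64 A_g e^{2H(R)} R² H(R))`,
`f = pairDecayExponent`, `A_g = Σ_e |g e/√2|`, `H` = harmonic numbers — uniformly in `L`, `U`, `μ`. Proof: the
graph bound with the SHIFTED radial potential `ψ = φ - qH(R)` (`q = 1/(1+128β|t|)`): the observable pays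
`e^{ψ_o+ψ_{o'}} ≤ e^{q-2qH(R)}`, the hopping pays `e^{128β|t|q²H(R)}` (Dirichlet energy of `φ`, unchanged by the
shift), and the source — supported on the ball of radius `R` only, where `|ψ| ≤ qH(R)` — pays
`exp(β|h|·64A_g e^{2qH(R)}R²H(R))` (`sourceCost_shifted_le`); `2q - 128β|t|q² = f` and `H(R) ≥ log(R+1)`.
[cite: KomaTasakiPRL1992, eqs. (5)–(12) and footnote [10]] [cite: McBryanSpencer1977] -/
theorem norm_gibbsState_bondPair_pairSource_torus_le (t U μ h : ℝ) {β : ℝ} (hβ : 0 ≤ β)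
    (o o' : TorusSite 2 L) (ho' : torusDist o' o ≤ 1) (R : ℕ) :
    ‖gibbsState β (hubbardTorusWith 2 L t U μ - (h : ℂ) • (pairField g L + (pairField g L)ᴴ))
        (bondPair (FermionTorus.ofTorusSite o) (FermionTorus.ofTorusSite o'))‖ ≤
      2 * Real.exp 1 * ((R : ℝ) + 1) ^ (-pairDecayExponent (β * |t|)) *
        Real.exp (β * (|h| * (64 * (∑ e ∈ insert (0 : Site 2) unitSteps, |g e / Real.sqrt 2|) *
          Real.exp (2 * (harmonic R : ℝ)) * (R : ℝ) ^ 2 * (harmonic R : ℝ)))) := by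
  -- constants, as in `norm_thermalCorr_bondPair_torus_le`
  set B : ℝ := 128 * (β * |t|) with hB
  have hB0 : 0 ≤ B := by positivity
  set q : ℝ := 1 / (1 + B) with hq
  have hq0 : 0 < q := by positivity
  have hq1 : q ≤ 1 := by
    rw [hq, div_le_one (by positivity)]
    linarith
  set f : ℝ := 2 * q - B * q ^ 2 with hf
  have hfeq : pairDecayExponent (β * |t|) = f := by
    rw [pairDecayExponent_eq (by positivity : 0 ≤ β * |t|)]
  set S : Finset (Site 2) := insert (0 : Site 2) unitSteps with hS
  set A : ℝ := ∑ e ∈ S, |g e / Real.sqrt 2| with hA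
  have hA0 : 0 ≤ A := formFactorWeight_nonneg g
  set HR : ℝ := (harmonic R : ℝ) with hHR
  have hHR0 : 0 ≤ HR := by
    have := harmonic_mono_cast (Nat.zero_le R)
    rw [harmonic_zero, Rat.cast_zero] at this
    exact this
  -- rewrite the source as a bond-pair source and apply the graph bound with the shifted potential
  rw [pairField_add_conjTranspose_eq_bondPairSource]
  have key := norm_gibbsState_bondPair_sourced_le_exp (fermionTorusGraph 2 L) t U μ h hβ
    (fun u => radialPotential L o R q (FermionTorus.toTorusSite u) - q * HR)
    ((Finset.univ : Finset (TorusSite 2 L)) ×ˢ S)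
    (fun p => g p.2 / Real.sqrt 2) (fun p => FermionTorus.ofTorusSite p.1)
    (fun p => FermionTorus.ofTorusSite (p.1 + Torus.proj L p.2))
    (FermionTorus.ofTorusSite o) (FermionTorus.ofTorusSite o')
  simp only [FermionTorus.toTorusSite_ofTorusSite] at key
  -- the hopping sum, transported to `TorusSite` and stripped of the constant shift
  have hsumeq : (∑ u : FermionTorus 2 L, ∑ v : FermionTorus 2 L,
      if (fermionTorusGraph 2 L).Adj u v then
        2 * (Real.cosh ((radialPotential L o R q (FermionTorus.toTorusSite u) - q * HR) -
          (radialPotential L o R q (FermionTorus.toTorusSite v) - q * HR)) - 1)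
      else 0) =
      ∑ a : TorusSite 2 L, ∑ b : TorusSite 2 L,
        if (torusGraph 2 L).Adj a b then
          2 * (Real.cosh (radialPotential L o R q a - radialPotential L o R q b) - 1) else 0 := by
    refine Fintype.sum_equiv FermionTorus.equivTorusSite _ _ fun u => ?_
    refine Fintype.sum_equiv FermionTorus.equivTorusSite _ _ fun v => ?_
    simp [FermionTorus.equivTorusSite, sub_sub_sub_cancel_right]
  rw [hsumeq] at key
  refine Eq.trans_le ?_ (key.trans ?_)
  · congr!
  -- the observable's gauge factor
  have hψo : radialPotential L o R q o - q * HR = -(q * HR) := by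
    rw [radialPotential_center]; ring
  have hψo' : radialPotential L o R q o' - q * HR ≤ q - q * HR := by
    linarith [radialPotential_le_of o R hq0.le ho']
  have hexp : (radialPotential L o R q o - q * HR) + (radialPotential L o R q o' - q * HR) ≤
      -2 * (q * HR) + 1 := by
    rw [hψo]; linarith
  -- the hopping cost
  have hE := radialPotential_energy_le (L := L) o R hq0.le hq1
  have hβt : 0 ≤ β * |t| := by positivity
  have hhop : |t| * (∑ a : TorusSite 2 L, ∑ b : TorusSite 2 L,
      if (torusGraph 2 L).Adj a b then
        2 * (Real.cosh (radialPotential L o R q a - radialPotential L o R q b) - 1) else 0) ≤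
      |t| * (128 * q ^ 2 * HR) := mul_le_mul_of_nonneg_left hE (abs_nonneg t)
  -- the source cost
  have hsrc := sourceCost_shifted_le g (L := L) o R hq0.le
  have hsrc' : |h| * (∑ p ∈ (Finset.univ : Finset (TorusSite 2 L)) ×ˢ S,
      |g p.2 / Real.sqrt 2| * (4 * (Real.cosh
        ((radialPotential L o R q p.1 - q * HR) +
          (radialPotential L o R q (p.1 + Torus.proj L p.2) - q * HR)) - 1))) ≤
      |h| * (64 * A * Real.exp (2 * HR) * (R : ℝ) ^ 2 * HR) := by
    refine mul_le_mul_of_nonneg_left (hsrc.trans ?_) (abs_nonneg h)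
    have hq' : 2 * (q * HR) ≤ 2 * HR := by nlinarith
    gcongr
  -- assemble
  have hRpos : (0 : ℝ) < (R : ℝ) + 1 := by positivity
  have hHRlog : Real.log ((R : ℝ) + 1) ≤ HR := by
    have := log_add_one_le_harmonic R
    push_cast at this
    exact this
  calc 2 * Real.exp ((radialPotential L o R q o - q * HR) + (radialPotential L o R q o' - q * HR)) *
        Real.exp (β * (|t| * (∑ a : TorusSite 2 L, ∑ b : TorusSite 2 L,
          if (torusGraph 2 L).Adj a b then
            2 * (Real.cosh (radialPotential L o R q a - radialPotential L o R q b) - 1) else 0) +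
          |h| * (∑ p ∈ (Finset.univ : Finset (TorusSite 2 L)) ×ˢ S,
            |g p.2 / Real.sqrt 2| * (4 * (Real.cosh
              ((radialPotential L o R q p.1 - q * HR) +
                (radialPotential L o R q (p.1 + Torus.proj L p.2) - q * HR)) - 1)))))
      ≤ 2 * Real.exp (-2 * (q * HR) + 1) *
          Real.exp (β * (|t| * (128 * q ^ 2 * HR) +
            |h| * (64 * A * Real.exp (2 * HR) * (R : ℝ) ^ 2 * HR))) := by
        gcongr
    _ = 2 * Real.exp 1 * Real.exp (-(f * HR)) *
          Real.exp (β * (|h| * (64 * A * Real.exp (2 * HR) * (R : ℝ) ^ 2 * HR))) := by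
        have hsum : (-2 * (q * HR) + 1) +
            β * (|t| * (128 * q ^ 2 * HR) + |h| * (64 * A * Real.exp (2 * HR) * (R : ℝ) ^ 2 * HR)) =
            1 + -(f * HR) + β * (|h| * (64 * A * Real.exp (2 * HR) * (R : ℝ) ^ 2 * HR)) := by
          rw [hf, hB]; ring
        rw [mul_assoc 2 (Real.exp _) (Real.exp _), ← Real.exp_add, hsum, Real.exp_add, Real.exp_add]
        ring
    _ ≤ 2 * Real.exp 1 * Real.exp (-(f * Real.log ((R : ℝ) + 1))) *
          Real.exp (β * (|h| * (64 * A * Real.exp (2 * HR) * (R : ℝ) ^ 2 * HR))) := by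
        have hf0 : 0 < f := by rw [← hfeq]; exact pairDecayExponent_pos hβt
        gcongr
    _ = 2 * Real.exp 1 * ((R : ℝ) + 1) ^ (-pairDecayExponent (β * |t|)) *
          Real.exp (β * (|h| * (64 * A * Real.exp (2 * HR) * (R : ℝ) ^ 2 * HR))) := by
        rw [hfeq, Real.rpow_def_of_pos hRpos]
        congr 3
        ring


/-- **One-point bound for the local pair field under the pair-field source, on `(ℤ/Lℤ)²`**: for every form
factor `g`, all `t, U, μ, h`, `β ≥ 0`, every site `o` and every radius `R`,
`|⟨P_o⟩_{β,h,L}| ≤ A_g · 2e (R+1)^{-f(β|t|)} exp(β|h|·64 A_g e^{2H(R)} R² H(R))` (`P_o = localPair g L o`),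
uniformly in `L`, `U`, `μ`, `o`. [cite: KomaTasakiPRL1992, eqs. (5)–(12) and footnote [10]] [cite: SuSuzuki1998, (13)–(14)] -/
theorem norm_gibbsState_localPair_pairSource_torus_le (t U μ h : ℝ) {β : ℝ} (hβ : 0 ≤ β)
    (o : TorusSite 2 L) (R : ℕ) :
    ‖gibbsState β (hubbardTorusWith 2 L t U μ - (h : ℂ) • (pairField g L + (pairField g L)ᴴ))
        (localPair g L o)‖ ≤
      (∑ e ∈ insert (0 : Site 2) unitSteps, |g e / Real.sqrt 2|) *
        (2 * Real.exp 1 * ((R : ℝ) + 1) ^ (-pairDecayExponent (β * |t|)) *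
          Real.exp (β * (|h| * (64 * (∑ e ∈ insert (0 : Site 2) unitSteps, |g e / Real.sqrt 2|) *
            Real.exp (2 * (harmonic R : ℝ)) * (R : ℝ) ^ 2 * (harmonic R : ℝ))))) := by
  set S : Finset (Site 2) := insert (0 : Site 2) unitSteps with hS
  set D : ℝ := 2 * Real.exp 1 * ((R : ℝ) + 1) ^ (-pairDecayExponent (β * |t|)) *
    Real.exp (β * (|h| * (64 * (∑ e ∈ S, |g e / Real.sqrt 2|) *
      Real.exp (2 * (harmonic R : ℝ)) * (R : ℝ) ^ 2 * (harmonic R : ℝ)))) with hD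
  set H : Matrix (Finset (Orb (FermionTorus 2 L))) (Finset (Orb (FermionTorus 2 L))) ℂ :=
    hubbardTorusWith 2 L t U μ - (h : ℂ) • (pairField g L + (pairField g L)ᴴ) with hH
  rw [localPair_eq_sum_bondPair, map_sum]
  calc ‖∑ e ∈ S, gibbsState β H (((g e / Real.sqrt 2 : ℝ) : ℂ) •
        bondPair (FermionTorus.ofTorusSite o) (FermionTorus.ofTorusSite (o + Torus.proj L e)))‖
      ≤ ∑ e ∈ S, |g e / Real.sqrt 2| * D := by
        refine (norm_sum_le _ _).trans (Finset.sum_le_sum fun e he => ?_)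
        rw [map_smul, smul_eq_mul, norm_mul, Complex.norm_real, Real.norm_eq_abs]
        refine mul_le_mul_of_nonneg_left ?_ (abs_nonneg _)
        exact norm_gibbsState_bondPair_pairSource_torus_le g t U μ h hβ o _
          (torusDist_add_proj_le_one o he) R
    _ = (∑ e ∈ S, |g e / Real.sqrt 2|) * D := by rw [Finset.sum_mul]

/-- **No sourced pair-field order at positive temperature in two dimensions (quasi-average form of the
Hohenberg–Mermin–Wagner barrier; Su–Suzuki 1998), uniformly in the volume.** For every form factor `g`,
hopping `t` and `β ≥ 0`: for every `ε > 0` there is `h₀ > 0` such that for all source strengths `|h| ≤ h₀`,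
ALL sides `L`, all `U` (either sign), `μ` (any filling) and sites `o`, the thermal one-point function of the local
pair field in the sourced Gibbs state obeys `|⟨P_o⟩_{β,h,L}| ≤ ε`. In particular
`lim_{h→0} limsup_{L→∞} |⟨P_o⟩_{β,h,L}| = 0`: the Bogoliubov quasi-average of the pair field vanishes at every
`T > 0` — whereas at `T = 0` the corresponding object (`dWaveOrderParameter`, Koma–Tasaki) is the OPEN content
of the superconducting routes. Proof: `norm_gibbsState_localPair_pairSource_torus_le` with `R` large, then `h₀`
small. [cite: SuSuzuki1998, abstract and (13)–(14)] [cite: KomaTasakiPRL1992, p. 3 and footnote [10]] -/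
theorem gibbsState_localPair_pairSource_small (t : ℝ) {β : ℝ} (hβ : 0 ≤ β) {ε : ℝ} (hε : 0 < ε) :
    ∃ h₀ : ℝ, 0 < h₀ ∧ ∀ h : ℝ, |h| ≤ h₀ → ∀ (L : ℕ) [NeZero L] (U μ : ℝ) (o : TorusSite 2 L),
      ‖gibbsState β (hubbardTorusWith 2 L t U μ - (h : ℂ) • (pairField g L + (pairField g L)ᴴ))
          (localPair g L o)‖ ≤ ε := by
  set A : ℝ := ∑ e ∈ insert (0 : Site 2) unitSteps, |g e / Real.sqrt 2| with hA
  have hA0 : 0 ≤ A := formFactorWeight_nonneg g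
  set f : ℝ := pairDecayExponent (β * |t|) with hf
  have hf0 : 0 < f := pairDecayExponent_pos (by positivity)
  -- choose the radius: `A · 2e · (R+1)^{-f} ≤ ε/3`
  have hlim : Filter.Tendsto (fun R : ℕ => A * (2 * Real.exp 1 * ((R : ℝ) + 1) ^ (-f)))
      Filter.atTop (nhds (A * (2 * Real.exp 1 * 0))) := by
    refine tendsto_const_nhds.mul (tendsto_const_nhds.mul ?_)
    exact (tendsto_rpow_neg_atTop hf0).comp
      (Filter.tendsto_atTop_add_const_right _ 1 tendsto_natCast_atTop_atTop)
  rw [mul_zero, mul_zero] at hlim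
  obtain ⟨R, hR⟩ := (hlim.eventually_le_const (by positivity : (0 : ℝ) < ε / 3)).exists
  -- choose the source strength: `β |h| K_R ≤ 1`
  set K : ℝ := 64 * A * Real.exp (2 * (harmonic R : ℝ)) * (R : ℝ) ^ 2 * (harmonic R : ℝ) with hK
  have hHR0 : 0 ≤ (harmonic R : ℝ) := by
    have := harmonic_mono_cast (Nat.zero_le R)
    rw [harmonic_zero, Rat.cast_zero] at this
    exact this
  have hK0 : 0 ≤ K := by positivity
  refine ⟨1 / (β * K + 1), by positivity, fun h hh L _ U μ o => ?_⟩
  have hβhK : β * (|h| * K) ≤ 1 := by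
    calc β * (|h| * K) = |h| * (β * K) := by ring
      _ ≤ 1 / (β * K + 1) * (β * K) := mul_le_mul_of_nonneg_right hh (by positivity)
      _ ≤ 1 := by
          rw [div_mul_eq_mul_div, one_mul, div_le_one (by positivity)]
          linarith
  calc ‖gibbsState β (hubbardTorusWith 2 L t U μ - (h : ℂ) • (pairField g L + (pairField g L)ᴴ))
        (localPair g L o)‖
      ≤ A * (2 * Real.exp 1 * ((R : ℝ) + 1) ^ (-f) * Real.exp (β * (|h| * K))) :=
        norm_gibbsState_localPair_pairSource_torus_le g t U μ h hβ o R
    _ ≤ A * (2 * Real.exp 1 * ((R : ℝ) + 1) ^ (-f) * Real.exp 1) := by gcongr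
    _ = A * (2 * Real.exp 1 * ((R : ℝ) + 1) ^ (-f)) * Real.exp 1 := by ring
    _ ≤ ε / 3 * Real.exp 1 := mul_le_mul_of_nonneg_right hR (Real.exp_pos 1).le
    _ ≤ ε / 3 * 3 := by
        gcongr
        have := Real.exp_one_lt_d9
        linarith
    _ = ε := by ring

/-- **The sourced pair-field DENSITY vanishes at every `T > 0`, uniformly in the volume**: with `h₀(β, ε)` as
above, `|⟨Δ_g⟩_{β,h,L}| / L² ≤ ε` for all `|h| ≤ h₀`, all `L ≥ 1`, `U`, `μ` (`Δ_g = pairField g L = Σ_o P_o`,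
`L²` sites). [cite: SuSuzuki1998, (3) and (13)–(14)] -/
theorem gibbsState_pairField_density_small (t : ℝ) {β : ℝ} (hβ : 0 ≤ β) {ε : ℝ} (hε : 0 < ε) :
    ∃ h₀ : ℝ, 0 < h₀ ∧ ∀ h : ℝ, |h| ≤ h₀ → ∀ (L : ℕ) [NeZero L] (U μ : ℝ),
      ‖gibbsState β (hubbardTorusWith 2 L t U μ - (h : ℂ) • (pairField g L + (pairField g L)ᴴ))
          (pairField g L)‖ / (L : ℝ) ^ 2 ≤ ε := by
  obtain ⟨h₀, hh₀, hsmall⟩ := gibbsState_localPair_pairSource_small g t hβ hε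
  refine ⟨h₀, hh₀, fun h hh L _ U μ => ?_⟩
  have hL : (0 : ℝ) < (L : ℝ) ^ 2 := by
    have : (0 : ℝ) < L := by exact_mod_cast Nat.pos_of_ne_zero (NeZero.ne L)
    positivity
  rw [div_le_iff₀ hL, pairField, map_sum]
  have hcard : (Fintype.card (TorusSite 2 L) : ℝ) = (L : ℝ) ^ 2 := by
    rw [Fintype.card_pi, prod_const, ZMod.card, card_univ, Fintype.card_fin]
    push_cast
    ring
  calc ‖∑ o : TorusSite 2 L, gibbsState β
        (hubbardTorusWith 2 L t U μ - (h : ℂ) • (pairField g L + (pairField g L)ᴴ)) (localPair g L o)‖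
      ≤ ∑ o : TorusSite 2 L, ε :=
        (norm_sum_le _ _).trans (Finset.sum_le_sum fun o _ => hsmall h hh L U μ o)
    _ = ε * (L : ℝ) ^ 2 := by rw [Finset.sum_const, nsmul_eq_mul, card_univ, hcard]; ring

/-- **The `d_{x²-y²}` case in the tree's vocabulary: the THERMAL sourced `d`-wave order-parameter density
vanishes at every `T > 0`.** For `t = 1`, `g = dWaveFormFactor` the sourced Hamiltonian is the tree's
`dWaveSourceTorus L U μ h = H(1,U) - μN - h(Δ_d + Δ_d†)` (Koma–Tasaki's source), whose GROUND-STATE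
functional defines `dWaveSourceDensity` / `dWaveOrderParameter` / `HasDWaveOrder` (the object of crux
`WcbcsBcsConstruction` of route WeakCouplingBCS). Its Gibbs state at any `0 ≤ β < ∞` carries NO `d`-wave
order in the quasi-average sense: for every `ε > 0` there is `h₀ > 0` with
`|⟨Δ_d⟩_{β,h,L}| / L² ≤ ε` for all `|h| ≤ h₀`, all `L`, `U`, `μ` — so `lim_{h↓0} limsup_L |⟨Δ_d⟩_{β,h,L}|/L² = 0`.
The positive-temperature twin of `HasDWaveOrder` is therefore identically false; only the `T = 0` order
parameter can carry the superconducting routes. [cite: SuSuzuki1998, abstract and (13)–(14)] [cite: KomaTasaki1994, §1] -/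
theorem thermal_dWaveSourceDensity_small {β : ℝ} (hβ : 0 ≤ β) {ε : ℝ} (hε : 0 < ε) :
    ∃ h₀ : ℝ, 0 < h₀ ∧ ∀ h : ℝ, |h| ≤ h₀ → ∀ (L : ℕ) [NeZero L] (U μ : ℝ),
      ‖gibbsState β (dWaveSourceTorus L U μ h) (pairField dWaveFormFactor L)‖ / (L : ℝ) ^ 2 ≤ ε :=
  gibbsState_pairField_density_small dWaveFormFactor 1 hβ hε

end Torus

end Literature.Barriers.HubbardSuperconductivity
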